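import Literature.Geometry.Lorentzian.KerrRadiusPseudoconvexity
import Literature.Geometry.Lorentzian.KerrIngoingCoordPullback
import Literature.Geometry.Lorentzian.KerrAxialKillingField
import Literature.Geometry.Lorentzian.KerrNullShearFree
import Literature.Geometry.Lorentzian.KerrCurvatureInvariantsTransport
import HarnessLib

/-!
# The full radial-acceleration identity in the ingoing Kerr chart, and its Kerr–Schild dictionary

(family `gr`; namespace `Literature.Geometry.Lorentzian.Kerr[.Ingoing]`; sequel to
`KerrRadiusPseudoconvexity.lean`.)

`KerrRadiusPseudoconvexity.lean` proved `2Σ² hessR(u,w) − R′(r; E, L, Q) = c · g(w, w)` for vectors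
TANGENT to the cylinders (`wʳ = 0`). Here the tangency assumption is removed: for EVERY vector `w`
at a regular chart point,

  `Δ · 2Σ² hessR(u, w) = Δ · (4 E r P + c · g(w,w) − 2 Σ wʳ dΣ(w)) − (2r − 2M) · (P² − Σ² (wʳ)² + Σ Δ g(w,w))`

(`delta_mul_two_mul_sq_sigma_mul_hessR`; `P = E(r² + a²) − aL`, `dΣ(w) = 2r wʳ + 2a²μ w^μ`,
`c = 2(2r³ − 3Mr² + a²r + a²μ²(r − M))`; the last bracket is `Δ(Q + (L − aE)²)` by the radial identity,
so on the null cone this is `2Σ² r̈ = R′(r) − 2Σ Σ̇ ṙ`, the derivative of Carter's `Σ² ṙ² = R(r)`;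
Carter 1968, §4). The point of the `Δ`-multiplied, tangency-free form is that every term has a
SMOOTH Kerr–Schild Cartesian meaning, also on the symmetry axis where the chart is singular:

* `Kerr.ksEnergy`, `Kerr.ksAngMom` — `E = −g(∂_{t*}, w)`, `L = g(x∂_y − y∂_x, w)` in Kerr–Schild
  coordinates (`E4.axialGenerator`), and `Kerr.ksCarterQ` — the value `P²/Δ − (L − aE)²` that
  Carter's `Q` takes on a null vector tangent to the cylinder;
* the dictionary along the chart `Ψ` (`u` in the coordinate domain, `J_u` its Jacobian):
  `J_u ∂_{t*} = ∂_{t*}`, `J_u ∂_φ = x∂_y − y∂_x` (`jac_basisVector_zero/three`),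
  `Σ_KS(Ψu) = Σ(u)` for `Σ_KS = blSigma a ∘ spatial` (`blSigma_spatial_chartFun`),
  `dΣ_KS(J_u v) = 2r v¹ + 2a²μ v²` (`fderiv_blSigma_spatial_chartFun_jac`),
  `E_KS(Ψu, J_u v) = E(u, v)`, `L_KS(Ψu, J_u v) = L(u, v)`;
* continuity in `z`, on `Kerr.region a r₀`, of the Kerr–Schild quantities entering the identity
  (`continuousOn_hessAt_bilin_radius_apply` etc.), used in the sequel to push the identity, and
  with it the pseudo-convexity dichotomy, across the axis.

## References

* B. Carter, Comm. Math. Phys. 10 (1968) 280–310, §4.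
* B. O'Neill, *Semi-Riemannian geometry* (1983), Ch. 3, Prop. 3.13, Lemma 3.49.
-/

noncomputable section

set_option maxSynthPendingDepth 3

open Set Function Module Real
open scoped Topology ContDiff
open Literature.Geometry.Lorentzian.MetricCoord

namespace Literature.Geometry.Lorentzian

namespace Kerr

namespace Ingoing

variable {M a r₀ : ℝ} {u : E4}

/-! ### The full identity in the chart -/

/-- `∂_r g` is symmetric. [folklore] -/
theorem bilinR_symm (u v w : E4) : bilinR M a u v w = bilinR M a u w v := by
  rw [bilinR_apply, bilinR_apply]; ring

/-- **The radial acceleration in closed form, for an arbitrary vector**: on the regular set,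
`2 hessR(u, w) = (Δ/Σ)(∂_r g)(w,w) − 2wʳ (∂_r g)(w, ∇r) − 2w^μ (∂_μ g)(w, ∇r)`
(`2 g(Γ(w,w), ∇r) = 2∂_w g(w,∇r) − ∂_{∇r} g(w,w)`). [cite: ONeill1983, Ch. 3, Prop. 3.13] -/
theorem two_mul_hessR_eq_of_regular (hu : u ∈ regularSet a) (w : E4) :
    2 * hessR M a u w =
      (u 1 ^ 2 - 2 * M * u 1 + a ^ 2) / sigma a u * bilinR M a u w w -
        2 * w 1 * bilinR M a u w (gradR M a u) - 2 * w 2 * bilinM M a u w (gradR M a u) := by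
  have hS := hu.1
  have h1 : chrAt (bilin M a) u w w 1 = bilin M a u (chrAt (bilin M a) u w w) (gradR M a u) :=
    (bilin_gradR hS _).symm
  have h2 : 2 * bilin M a u (chrAt (bilin M a) u w w) (gradR M a u) =
      koszulCLM (bilin M a) u w w (gradR M a u) :=
    two_mul_apply_chrAt (isInvertible_bilin M a hu) w w (gradR M a u)
  have h3 : koszulCLM (bilin M a) u w w (gradR M a u) =
      2 * w 1 * bilinR M a u w (gradR M a u) + 2 * w 2 * bilinM M a u w (gradR M a u) -
        (u 1 ^ 2 - 2 * M * u 1 + a ^ 2) / sigma a u * bilinR M a u w w := by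
    rw [koszulCLM_eq_koszulForm, koszulForm_bilin M a hu, gradR_apply_one, gradR_apply_two,
      bilinM_symm u (gradR M a u) w, bilinR_symm u (gradR M a u) w]
    simp only [h00, scalarH]
    field_simp
    ring
  unfold hessR
  rw [h1]
  linarith [h2, h3]

/-- **The full radial-acceleration identity** (no tangency assumption). On the regular set, for
every vector `w`, with `E, L` its Killing constants, `P = E(r²+a²) − aL`, `g = g(w,w)`,
`dΣ(w) = 2r wʳ + 2a²μ w^μ` and `c = 2(2r³ − 3Mr² + a²r + a²μ²(r − M))`:
`Δ · 2Σ² hessR = Δ(4ErP + c g − 2Σ wʳ dΣ(w)) − (2r − 2M)(P² − Σ²(wʳ)² + ΣΔ g)`.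
Along a null geodesic (`g = 0`, `P² − Σ²ṙ² = ΔK` by the radial identity) this is
`2Σ² r̈ = R′(r) − 2ΣΣ̇ṙ`. [cite: Carter1968, §4] -/
theorem delta_mul_two_mul_sq_sigma_mul_hessR (hu : u ∈ regularSet a) (w : E4) :
    (u 1 ^ 2 - 2 * M * u 1 + a ^ 2) * (2 * sigma a u ^ 2 * hessR M a u w) =
      (u 1 ^ 2 - 2 * M * u 1 + a ^ 2) *
          (4 * energy M a u w * u 1 *
              (energy M a u w * (u 1 ^ 2 + a ^ 2) - a * angMom M a u w) +
            2 * (2 * u 1 ^ 3 - 3 * M * u 1 ^ 2 + a ^ 2 * u 1 + a ^ 2 * u 2 ^ 2 * (u 1 - M)) *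
              bilin M a u w w -
            2 * sigma a u * w 1 * (2 * u 1 * w 1 + 2 * a ^ 2 * u 2 * w 2)) -
        (2 * u 1 - 2 * M) *
          ((energy M a u w * (u 1 ^ 2 + a ^ 2) - a * angMom M a u w) ^ 2 -
            sigma a u ^ 2 * w 1 ^ 2 +
            sigma a u * (u 1 ^ 2 - 2 * M * u 1 + a ^ 2) * bilin M a u w w) := by
  have hS := hu.1
  have hP := hu.2
  have h2 : (u 1 ^ 2 - 2 * M * u 1 + a ^ 2) * (2 * sigma a u ^ 2 * hessR M a u w) =
      (u 1 ^ 2 - 2 * M * u 1 + a ^ 2) * sigma a u ^ 2 * (2 * hessR M a u w) := by ring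
  rw [h2, two_mul_hessR_eq_of_regular hu]
  rw [energy_eq, angMom_eq, bilin_apply, bilinR_apply, bilinR_apply, bilinM_apply]
  simp only [gradR_apply_zero, gradR_apply_one, gradR_apply_two, gradR_apply_three]
  simp only [h00, h03, c13, c22, c33, c22r, c22m, c33r, c33m, h00r, h00m, h03r, h03m, scalarH,
    scalarHr, scalarHm]
  field_simp
  simp only [sigma, sinSq] at hS hP ⊢
  ring

/-! ### The dictionary along the chart -/

/-- `(t, y⃗)¹ = y⃗⁰`. [folklore] -/
private theorem ofTimeSpace_apply_one (t : ℝ) (y : E3) : E4.ofTimeSpace t y 1 = y 0 :=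
  E4.ofTimeSpace_apply_succ t y 0

/-- `(t, y⃗)² = y⃗¹`. [folklore] -/
private theorem ofTimeSpace_apply_two (t : ℝ) (y : E3) : E4.ofTimeSpace t y 2 = y 1 :=
  E4.ofTimeSpace_apply_succ t y 1

/-- `(t, y⃗)³ = y⃗²`. [folklore] -/
private theorem ofTimeSpace_apply_three (t : ℝ) (y : E3) : E4.ofTimeSpace t y 3 = y 2 :=
  E4.ofTimeSpace_apply_succ t y 2

/-- `J_u ∂_{t*} = ∂_{t*}`. [folklore] -/
theorem jac_basisVector_zero (a : ℝ) (u : E4) : jac a u (E4.basisVector 0) = E4.basisVector 0 := by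
  ext i
  rw [jac_apply]
  fin_cases i
  · simp [E4.ofTimeSpace_apply_zero]
  · simp [ofTimeSpace_apply_one]
  · simp [ofTimeSpace_apply_two]
  · simp [ofTimeSpace_apply_three]

/-- On the coordinate domain `x = (r cos φ − a sin φ) s`, `s = √(1 − μ²)`. [folklore] -/
theorem chartFun_apply_one (hu : u ∈ coordDomain r₀) :
    chartFun a r₀ u 1 = (u 1 * cos (u 3) - a * sin (u 3)) * sroot u := by
  rw [chartFun_eq hu, ofTimeSpace_apply_one, kerrStar_apply_zero, sin_arccos_eq]

/-- On the coordinate domain `y = (r sin φ + a cos φ) s`. [folklore] -/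
theorem chartFun_apply_two (hu : u ∈ coordDomain r₀) :
    chartFun a r₀ u 2 = (u 1 * sin (u 3) + a * cos (u 3)) * sroot u := by
  rw [chartFun_eq hu, ofTimeSpace_apply_two, kerrStar_apply_one, sin_arccos_eq]

/-- **`J_u ∂_φ = x∂_y − y∂_x`**: the chart pushes the coordinate field `∂_φ` to the axial Killing
field of the Kerr–Schild chart (`E4.axialGenerator`). [folklore] -/
theorem jac_basisVector_three (hu : u ∈ coordDomain r₀) :
    jac a u (E4.basisVector 3) = E4.axialGenerator (chartFun a r₀ u) := by
  ext i
  rw [jac_apply, E4.axialGenerator_apply, chartFun_apply_one hu, chartFun_apply_two hu]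
  fin_cases i
  · simp [E4.ofTimeSpace_apply_zero]
  · simp [ofTimeSpace_apply_one, jacP]; ring
  · simp [ofTimeSpace_apply_two, jacP]
  · simp [ofTimeSpace_apply_three, jacP]

/-- **`Σ_KS ∘ Ψ = Σ`**: the Kerr–Schild Cartesian `Σ = 2r² − ‖x⃗‖² + a²` (`Kerr.blSigma`) is
`r² + a²μ²` in the chart. [folklore] -/
theorem blSigma_spatial_chartFun (hu : u ∈ coordDomain r₀) :
    blSigma a (E4.spatial (chartFun a r₀ u)) = sigma a u := by
  rw [chartFun_eq hu, E4.spatial_ofTimeSpace, blSigma_kerrStar a (radial_pos hu), cos_arccos_eq hu]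
  rfl

/-- The Kerr–Schild function `z ↦ Σ_KS(z) = blSigma a x⃗` is `2r² − (x² + y² + z²) + a²`, hence
`C^∞` wherever `r > 0`. [folklore] -/
theorem contDiffAt_blSigma_spatial {z : E4} (hz : 0 < radius a z) {n : WithTop ℕ∞} :
    ContDiffAt ℝ n (fun z : E4 ↦ blSigma a (E4.spatial z)) z := by
  have h : (fun z : E4 ↦ blSigma a (E4.spatial z)) =
      fun z ↦ 2 * radius a z ^ 2 - E4.spatialNorm z ^ 2 + a ^ 2 := funext (blSigma_spatial_eq a)
  rw [h]
  have h1 : ContDiffAt ℝ n (fun z : E4 ↦ E4.spatialNorm z ^ 2) z := by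
    have : (fun z : E4 ↦ E4.spatialNorm z ^ 2) = fun z ↦ z 1 ^ 2 + z 2 ^ 2 + z 3 ^ 2 :=
      funext E4.spatialNorm_sq
    rw [this]; fun_prop
  have h2 : ContDiffAt ℝ n (fun z : E4 ↦ radius a z ^ 2) z := (contDiffAt_radius hz).pow 2
  exact ((contDiffAt_const.mul h2).sub h1).add contDiffAt_const

/-- **`dΣ_KS(J_u v) = 2r v¹ + 2a²μ v²`** along the chart (chain rule; `Σ_KS ∘ Ψ = r² + a²μ²`).
[folklore] -/
theorem fderiv_blSigma_spatial_chartFun_jac (hu : u ∈ coordDomain r₀) (v : E4) :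
    fderiv ℝ (fun z : E4 ↦ blSigma a (E4.spatial z)) (chartFun a r₀ u) (jac a u v) =
      2 * u 1 * v 1 + 2 * a ^ 2 * u 2 * v 2 := by
  have hr : 0 < radius a (chartFun a r₀ u) := by
    rw [radius_chartFun]; exact radialParam_pos r₀ _
  have hcomp : HasFDerivAt ((fun z : E4 ↦ blSigma a (E4.spatial z)) ∘ chartFun a r₀)
      ((fderiv ℝ (fun z : E4 ↦ blSigma a (E4.spatial z)) (chartFun a r₀ u)).comp (jac a u)) u :=
    ((contDiffAt_blSigma_spatial hr (n := 1)).differentiableAt one_ne_zero).hasFDerivAt.comp u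
      (hasFDerivAt_chartFun hu)
  have hev : ((fun z : E4 ↦ blSigma a (E4.spatial z)) ∘ chartFun a r₀) =ᶠ[𝓝 u] sigma a := by
    filter_upwards [(coordDomain r₀).isOpen.mem_nhds hu] with y hy
    exact blSigma_spatial_chartFun hy
  have hsig : HasFDerivAt ((fun z : E4 ↦ blSigma a (E4.spatial z)) ∘ chartFun a r₀)
      ((2 * u 1) • E4.dx 1 + (2 * a ^ 2 * u 2) • E4.dx 2) u :=
    (hasGrad_sigma a u).congr_of_eventuallyEq hev
  have heq := hcomp.unique hsig
  have := congrArg (fun L : E4 →L[ℝ] ℝ ↦ L v) heq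
  simpa [E4.dx] using this

end Ingoing

/-! ### Kerr–Schild Cartesian constants of a vector -/

/-- The **Killing energy in Kerr–Schild coordinates**: `E = −g_z(∂_{t*}, w)` for the Kerr–Schild
form `g = Kerr.bilin M a z` (`∂_{t*}` is Killing, `Kerr.isKillingField_stationaryField`).
Carter 1968, §4. [cite: Carter1968, §4] -/
def ksEnergy (M a : ℝ) (z w : E4) : ℝ := -(Kerr.bilin M a z (E4.basisVector 0) w)

/-- The **axial angular momentum in Kerr–Schild coordinates**: `L = g_z(x∂_y − y∂_x, w)`
(`E4.axialGenerator z` is the axial Killing field, `Kerr.isKillingField_axialField`).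
Carter 1968, §4. [cite: Carter1968, §4] -/
def ksAngMom (M a : ℝ) (z w : E4) : ℝ := Kerr.bilin M a z (E4.axialGenerator z) w

/-- **The Carter constant of a tangential null ray, in Kerr–Schild coordinates**:
`Q = P²/Δ − (L − aE)²` with `P = E(r² + a²) − aL`, `r = Kerr.radius a z` — the value Carter's
constant of a NULL geodesic TANGENT to the cylinder `{r = r(z)}` must take (`R(r) = Σ²ṙ² = 0`
forces `Δ(Q + (L − aE)²) = P²`; Carter 1968, §4). A smooth function of `(z, w)` off the horizons,
axis included. [cite: Carter1968, §4] -/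
def ksCarterQ (M a : ℝ) (z w : E4) : ℝ :=
  (ksEnergy M a z w * (radius a z ^ 2 + a ^ 2) - a * ksAngMom M a z w) ^ 2 /
      (radius a z ^ 2 - 2 * M * radius a z + a ^ 2) -
    (ksAngMom M a z w - a * ksEnergy M a z w) ^ 2

namespace Ingoing

variable {M a r₀ : ℝ} {u : E4}

/-- `E_KS(Ψu, J_u v) = E(u, v)`. [folklore] -/
theorem ksEnergy_chartFun_jac (hu : u ∈ coordDomain r₀) (v : E4) :
    ksEnergy M a (chartFun a r₀ u) (jac a u v) = energy M a u v := by
  unfold ksEnergy energy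
  rw [show Kerr.bilin M a (chartFun a r₀ u) (E4.basisVector 0) (jac a u v) =
      Kerr.bilin M a (chartFun a r₀ u) (jac a u (E4.basisVector 0)) (jac a u v) by
    rw [jac_basisVector_zero], kerrBilin_jac hu]

/-- `L_KS(Ψu, J_u v) = L(u, v)`. [folklore] -/
theorem ksAngMom_chartFun_jac (hu : u ∈ coordDomain r₀) (v : E4) :
    ksAngMom M a (chartFun a r₀ u) (jac a u v) = angMom M a u v := by
  unfold ksAngMom angMom
  rw [← jac_basisVector_three hu, kerrBilin_jac hu]

end Ingoing

/-! ### Continuity of the Kerr–Schild quantities on the chart domain -/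

section Continuity

variable (M a r₀ : ℝ)

/-- The radius is `C^∞` on the chart domain. [folklore] -/
theorem contDiffOn_radius_region : ContDiffOn ℝ ∞ (radius a) (region a r₀ : Set E4) :=
  fun _ hx ↦ (contDiffAt_radius (radius_pos_of_mem_region hx)).contDiffWithinAt

/-- `z ↦ g_z(v, w)` is continuous on the chart domain. [folklore] -/
theorem continuousOn_bilin_apply (v w : E4) :
    ContinuousOn (fun z : E4 ↦ Kerr.bilin M a z v w) (region a r₀) :=
  ((KerrSchildChart.isMetricOn_kerrBilin M a r₀).contDiffOn.continuousOn.clm_apply continuousOn_const).clm_apply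
    continuousOn_const

/-- `z ↦ L_KS(z, w)` is continuous on the chart domain. [folklore] -/
theorem continuousOn_ksAngMom (w : E4) :
    ContinuousOn (fun z : E4 ↦ ksAngMom M a z w) (region a r₀) := by
  unfold ksAngMom
  exact ((KerrSchildChart.isMetricOn_kerrBilin M a r₀).contDiffOn.continuousOn.clm_apply
    (E4.axialGenerator.continuous.continuousOn)).clm_apply continuousOn_const

/-- `z ↦ E_KS(z, w)` is continuous on the chart domain. [folklore] -/
theorem continuousOn_ksEnergy (w : E4) :
    ContinuousOn (fun z : E4 ↦ ksEnergy M a z w) (region a r₀) :=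
  (continuousOn_bilin_apply M a r₀ _ w).neg

/-- `z ↦ dr_z(w)` is continuous on the chart domain. [folklore] -/
theorem continuousOn_fderiv_radius_apply (w : E4) :
    ContinuousOn (fun z : E4 ↦ fderiv ℝ (radius a) z w) (region a r₀) :=
  ((contDiffOn_radius_region a r₀).continuousOn_fderiv_of_isOpen (region a r₀).isOpen
    (by exact_mod_cast le_top)).clm_apply continuousOn_const

/-- `z ↦ D²r_z(v, w)` is continuous on the chart domain. [folklore] -/
theorem continuousOn_fderiv_fderiv_radius_apply (v w : E4) :
    ContinuousOn (fun z : E4 ↦ fderiv ℝ (fderiv ℝ (radius a)) z v w) (region a r₀) := by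
  have h1 : ContDiffOn ℝ ∞ (fderiv ℝ (radius a)) (region a r₀ : Set E4) :=
    (contDiffOn_radius_region a r₀).fderiv_of_isOpen (region a r₀).isOpen (by exact_mod_cast le_top)
  exact ((h1.continuousOn_fderiv_of_isOpen (region a r₀).isOpen
    (by exact_mod_cast le_top)).clm_apply continuousOn_const).clm_apply continuousOn_const

/-- `z ↦ dΣ_KS,z(w)` is continuous on the chart domain. [folklore] -/
theorem continuousOn_fderiv_blSigma_spatial_apply (w : E4) :
    ContinuousOn (fun z : E4 ↦ fderiv ℝ (fun z : E4 ↦ blSigma a (E4.spatial z)) z w)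
      (region a r₀) := by
  have h : ContDiffOn ℝ ∞ (fun z : E4 ↦ blSigma a (E4.spatial z)) (region a r₀ : Set E4) :=
    fun _ hx ↦ (Ingoing.contDiffAt_blSigma_spatial (radius_pos_of_mem_region hx)).contDiffWithinAt
  exact (h.continuousOn_fderiv_of_isOpen (region a r₀).isOpen (by exact_mod_cast le_top)).clm_apply
    continuousOn_const

/-- `z ↦ Σ_KS(z)` is continuous on the chart domain. [folklore] -/
theorem continuousOn_blSigma_spatial :
    ContinuousOn (fun z : E4 ↦ blSigma a (E4.spatial z)) (region a r₀) :=
  fun _ hx ↦ (Ingoing.contDiffAt_blSigma_spatial (radius_pos_of_mem_region hx)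
    (n := 0)).continuousAt.continuousWithinAt

/-- **`z ↦ Hess r_z(v, w)` is continuous on the chart domain**: `Γ` of the Kerr–Schild components
is `C^∞` there (`IsMetricOn.contDiffOn_chrAt`) and `r` is `C^∞`. [cite: ONeill1983, Ch. 3, Lemma 3.49] -/
theorem continuousOn_hessAt_bilin_radius_apply (v w : E4) :
    ContinuousOn (fun z : E4 ↦ hessAt (Kerr.bilin M a) (radius a) z v w) (region a r₀) := by
  have hΓ : ContinuousOn (fun z : E4 ↦ chrAt (Kerr.bilin M a) z v w) (region a r₀) :=
    (((KerrSchildChart.isMetricOn_kerrBilin M a r₀).contDiffOn_chrAt.continuousOn).clm_apply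
      continuousOn_const).clm_apply continuousOn_const
  have hdr : ContinuousOn (fun z : E4 ↦ fderiv ℝ (radius a) z) (region a r₀) :=
    (contDiffOn_radius_region a r₀).continuousOn_fderiv_of_isOpen (region a r₀).isOpen
      (by exact_mod_cast le_top)
  have h : (fun z : E4 ↦ hessAt (Kerr.bilin M a) (radius a) z v w) = fun z ↦
      fderiv ℝ (fderiv ℝ (radius a)) z v w - fderiv ℝ (radius a) z (chrAt (Kerr.bilin M a) z v w) :=
    funext fun z ↦ hessAt_apply _ _ _ _ _
  rw [h]
  exact (continuousOn_fderiv_fderiv_radius_apply a r₀ v w).sub (hdr.clm_apply hΓ)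

end Continuity

end Kerr

end Literature.Geometry.Lorentzian

end
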